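import Summits.QuantumAdvantage.QuantumAdvantage.Theorems.WbwObfuscatedGluedTreesKowBbVocabulary

/-!
# Stub `stub_coupling` — re-randomising a Game-1 naming by a uniform injection is uniform
# (crux `WbwObfuscatedGluedTrees`, stmt-QuantumAdvantage-2340; line `knowledge-of-walk-split`, stage 5, lead c4)

Registered stub of the stage-5 skeleton `Cruxes/WbwObfuscatedGluedTrees/Lines/knowledge_of_walk_split.lean`
(target `…KnowledgeOfWalkSplit.BlackBox.BlackBoxSoundness`, conjunct (ii): Childs et al. 2003 Theorem 9 at every
name length `N ≥ 2n` with a random entrance name).  The map `(ν, g) ↦ g ∘ ν` from (Game-1 naming by `2n`-bit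
strings with `name(ENTRANCE) = 0^{2n}`, injection `{0,1}^{2n} ↪ {0,1}^N`) to the injective `N`-bit namings
`NamingN n N` has all fibres of the same size — any two `N`-bit namings differ by a permutation `π` of `{0,1}^N`
(`exists_perm_trans`), and `g ↦ π ∘ g` carries one fibre onto the other — so counting an event `W` of `N`-bit
outcomes directly or through the triples `(σ, ν, g)` agree up to the constant factors; stated cross-multiplied
(no division; both sides vanish when `Naming n` is empty, i.e. `n ≤ 1`).  Pure finite combinatorics.
-/

set_option linter.dupNamespace false

namespace Summit.QuantumAdvantage.QuantumAdvantage.Theorems.WbwObfuscatedGluedTrees.KnowledgeOfWalk.BlackBox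

open Literature.Computability.Complexity Literature.Computability.QuantumComplexity
open Literature.Computability.QuantumComplexity.GluedTrees
open Literature.Computability.Cryptography Literature.Computability.Cryptography.ObfuscatedGluedTrees

variable {n N : ℕ}

/-- Any two injective `N`-bit namings of `V(G'_n)` differ by a permutation of `{0,1}^N` (extend the bijection
between their ranges). [folklore] -/
theorem exists_perm_trans (ν₁ ν₂ : NamingN n N) :
    ∃ π : Equiv.Perm (Fin N → Bool), ν₁.trans π.toEmbedding = ν₂ := by
  classical
  let e : {y // y ∈ Set.range ν₁} ≃ {y // y ∈ Set.range ν₂} :=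
    (Equiv.ofInjective ν₁ ν₁.injective).symm.trans (Equiv.ofInjective ν₂ ν₂.injective)
  refine ⟨Equiv.extendSubtype e, Function.Embedding.ext fun v => ?_⟩
  show Equiv.extendSubtype e (ν₁ v) = ν₂ v
  rw [Equiv.extendSubtype_apply_of_mem e _ ⟨v, rfl⟩]
  simp [e, Equiv.ofInjective_symm_apply]

/-- **Stub `stub_coupling`** (re-randomisation is uniform): counting an event `W` on the `N`-bit outcomes and
counting `W (σ, g ∘ ν)` on the triples (cycle datum, Game-1 naming, injection `{0,1}^{2n} ↪ {0,1}^N`) agree up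
to the sizes of the two naming spaces, cross-multiplied. [folklore] -/
theorem stub_coupling : ∀ (n N : ℕ), 2 * n ≤ N → ∀ (W : OutcomeN n N → Prop) [DecidablePred W],
    (Finset.univ.filter W).card * Fintype.card (Naming n × (Name n ↪ (Fin N → Bool))) =
      (Finset.univ.filter fun τ : CycleDatum n × Naming n × (Name n ↪ (Fin N → Bool)) =>
          W (τ.1, τ.2.1.1.trans τ.2.2)).card * Fintype.card (NamingN n N) := by
  intro n N _ W _
  classical
  let G : Type := Name n ↪ (Fin N → Bool)
  let Φ : Naming n × G → NamingN n N := fun p => p.1.1.trans p.2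
  show (Finset.univ.filter W).card * Fintype.card (Naming n × G) =
    (Finset.univ.filter fun τ : CycleDatum n × Naming n × G => W (τ.1, Φ τ.2)).card * Fintype.card (NamingN n N)
  rcases isEmpty_or_nonempty (Naming n × G) with hE | hNE
  · -- no Game-1 naming (or no injection): both sides vanish
    have h1 : Fintype.card (Naming n × G) = 0 := Fintype.card_eq_zero
    have h2 : (Finset.univ.filter fun τ : CycleDatum n × Naming n × G => W (τ.1, Φ τ.2)).card = 0 := by
      rw [Finset.card_eq_zero, Finset.filter_eq_empty_iff]
      exact fun τ _ _ => hE.false τ.2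
    rw [h1, h2, Nat.mul_zero, Nat.zero_mul]
  · obtain ⟨p₀⟩ := hNE
    -- all fibres of `Φ` have the cardinality `F` of the fibre over `Φ p₀`
    have hfib : ∀ ν' : NamingN n N,
        Fintype.card {p : Naming n × G // Φ p = ν'} = Fintype.card {p : Naming n × G // Φ p = Φ p₀} := by
      intro ν'
      obtain ⟨π, hπ⟩ := exists_perm_trans ν' (Φ p₀)
      refine Fintype.card_congr
        ⟨fun p => ⟨(p.1.1, p.1.2.trans π.toEmbedding), by
            obtain ⟨⟨ν, g⟩, hp⟩ := p
            show ν.1.trans (g.trans π.toEmbedding) = Φ p₀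
            rw [← hπ, ← hp]
            rfl⟩,
          fun p => ⟨(p.1.1, p.1.2.trans π.symm.toEmbedding), by
            obtain ⟨⟨ν, g⟩, hp⟩ := p
            show ν.1.trans (g.trans π.symm.toEmbedding) = ν'
            have h : ν.1.trans g = ν'.trans π.toEmbedding := hp.trans hπ.symm
            refine Function.Embedding.ext fun v => ?_
            have hv := congrArg (fun e : NamingN n N => e v) h
            simp only [Function.Embedding.trans_apply, Equiv.coe_toEmbedding] at hv ⊢
            rw [hv, Equiv.symm_apply_apply]⟩, ?_, ?_⟩
      · rintro ⟨⟨ν, g⟩, hp⟩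
        apply Subtype.ext
        simp only [Prod.mk.injEq, true_and]
        exact Function.Embedding.ext fun a => by simp
      · rintro ⟨⟨ν, g⟩, hp⟩
        apply Subtype.ext
        simp only [Prod.mk.injEq, true_and]
        exact Function.Embedding.ext fun a => by simp
    -- hence `|Naming n × G| = |NamingN n N| · F`
    have hNG : Fintype.card (Naming n × G) =
        Fintype.card (NamingN n N) * Fintype.card {p : Naming n × G // Φ p = Φ p₀} := by
      rw [← Fintype.card_congr (Equiv.sigmaFiberEquiv Φ), Fintype.card_sigma,
        Finset.sum_congr rfl fun ν' _ => hfib ν', Finset.sum_const, Finset.card_univ, smul_eq_mul]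
    -- and `#{τ | W (σ, Φ (ν, g))} = #{ω | W ω} · F`
    have hcount : (Finset.univ.filter fun τ : CycleDatum n × Naming n × G => W (τ.1, Φ τ.2)).card =
        (Finset.univ.filter W).card * Fintype.card {p : Naming n × G // Φ p = Φ p₀} := by
      rw [Finset.card_eq_sum_card_fiberwise
        (f := fun τ : CycleDatum n × Naming n × G => ((τ.1, Φ τ.2) : OutcomeN n N))
        (s := Finset.univ.filter fun τ : CycleDatum n × Naming n × G => W (τ.1, Φ τ.2))
        (t := Finset.univ.filter W) fun τ hτ => by simpa using hτ]
      rw [← Finset.sum_const_nat fun ω _ => rfl]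
      refine Finset.sum_congr rfl fun ω hω => ?_
      have hWω : W ω := by simpa using hω
      rw [Finset.filter_filter, ← Fintype.card_subtype, ← hfib ω.2]
      refine Fintype.card_congr
        ⟨fun τ => ⟨τ.1.2, congrArg Prod.snd τ.2.2⟩, fun p => ⟨(ω.1, p.1), ?_⟩, ?_, ?_⟩
      · have hp : Φ p.1 = ω.2 := p.2
        rw [hp, Prod.mk.eta]
        exact ⟨hWω, rfl⟩
      · rintro ⟨⟨σ, p⟩, hτ⟩
        apply Subtype.ext
        have h1 : σ = ω.1 := congrArg Prod.fst hτ.2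
        simp [h1]
      · rintro ⟨p, hp⟩
        rfl
    rw [hNG, hcount]
    ring

end Summit.QuantumAdvantage.QuantumAdvantage.Theorems.WbwObfuscatedGluedTrees.KnowledgeOfWalk.BlackBox
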